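import Literature.NumberTheory.LFunctions.WeilFirstPrimeOddMarginCKappa
import Literature.NumberTheory.LFunctions.WeilFirstPrimeCertificateCCheck
import Literature.NumberTheory.LFunctions.WeilFirstPrimeCertificateCBlock1
import Literature.NumberTheory.LFunctions.WeilFirstPrimeOddMarginCRows0
import Literature.NumberTheory.LFunctions.WeilFirstPrimeOddMarginCRows1
import Literature.NumberTheory.LFunctions.WeilFirstPrimeOddMarginCRows2
import Literature.NumberTheory.LFunctions.WeilFirstPrimeOddMarginCRows3
import Literature.NumberTheory.LFunctions.WeilFirstPrimeOddMarginCRows4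
import Literature.NumberTheory.LFunctions.WeilFirstPrimeOddMarginCRows5
import Literature.NumberTheory.LFunctions.WeilFirstPrimeOddMarginCRows6
import Literature.NumberTheory.LFunctions.WeilFirstPrimeOddMarginCRows7
import Literature.NumberTheory.LFunctions.WeilFirstPrimeOddMarginCRows8
import Literature.NumberTheory.LFunctions.WeilFirstPrimeOddMarginCRows9
import Literature.NumberTheory.LFunctions.WeilFirstPrimeOddMarginCNu0
import Literature.NumberTheory.LFunctions.WeilFirstPrimeOddMarginCNu1
import Literature.NumberTheory.LFunctions.WeilFirstPrimeOddMarginCNu2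
import Literature.NumberTheory.LFunctions.WeilFirstPrimeOddMarginCNu3
import HarnessLib

/-!
# Odd-sector margin certificate C: assembly of the checks

`weilCertOddC` passes the cell check and the moment check (both LITERALLY those of `weilCert3C` up to the rescaling of the table, `…CNu*.lean`), the scalar
side conditions, and its ODD block passes `WeilCert.checkBlockK` at the lowered Bessel coefficient
`κ' = weilCertOddCKappa'` (`D C = I` rows: those of `weilCert3C`, definitionally; dominance rows: the sibling
`…CRows*.lean` files; `WeilCert.checkBlockK_of_rows`). These Booleans are what the odd-margin soundness
theorem consumes. Pure proof file; nothing is asserted.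
-/

noncomputable section

namespace Literature.NumberTheory.LFunctions

/-- **Kernel check of the cells** of certificate C (= the Stage-C cells check, same level, cut-off and cells). [folklore] -/
theorem checkCells_weilCertOddC :
    checkCells₃ weilCertOddC.base.prec weilCertOddC.j weilCertOddC.base.wL weilCertOddC.base.T weilCertOddC.base.mwT weilCertOddC.cells = true :=
  checkCells_weilCert3C

/-- **The moment table of certificate C is correct** (even entries `q ≤ 198`). [folklore] -/
theorem checkNu_weilCertOddC : weilCertOddC.checkNu = true := by
  refine WeilCert2.allBelow_of_forall fun k hk ↦ ?_
  have hk' : k < 100 := hk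
  interval_cases k
  · exact checkNuAt0_weilCertOddC
  · exact checkNuAt2_weilCertOddC
  · exact checkNuAt4_weilCertOddC
  · exact checkNuAt6_weilCertOddC
  · exact checkNuAt8_weilCertOddC
  · exact checkNuAt10_weilCertOddC
  · exact checkNuAt12_weilCertOddC
  · exact checkNuAt14_weilCertOddC
  · exact checkNuAt16_weilCertOddC
  · exact checkNuAt18_weilCertOddC
  · exact checkNuAt20_weilCertOddC
  · exact checkNuAt22_weilCertOddC
  · exact checkNuAt24_weilCertOddC
  · exact checkNuAt26_weilCertOddC
  · exact checkNuAt28_weilCertOddC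
  · exact checkNuAt30_weilCertOddC
  · exact checkNuAt32_weilCertOddC
  · exact checkNuAt34_weilCertOddC
  · exact checkNuAt36_weilCertOddC
  · exact checkNuAt38_weilCertOddC
  · exact checkNuAt40_weilCertOddC
  · exact checkNuAt42_weilCertOddC
  · exact checkNuAt44_weilCertOddC
  · exact checkNuAt46_weilCertOddC
  · exact checkNuAt48_weilCertOddC
  · exact checkNuAt50_weilCertOddC
  · exact checkNuAt52_weilCertOddC
  · exact checkNuAt54_weilCertOddC
  · exact checkNuAt56_weilCertOddC
  · exact checkNuAt58_weilCertOddC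
  · exact checkNuAt60_weilCertOddC
  · exact checkNuAt62_weilCertOddC
  · exact checkNuAt64_weilCertOddC
  · exact checkNuAt66_weilCertOddC
  · exact checkNuAt68_weilCertOddC
  · exact checkNuAt70_weilCertOddC
  · exact checkNuAt72_weilCertOddC
  · exact checkNuAt74_weilCertOddC
  · exact checkNuAt76_weilCertOddC
  · exact checkNuAt78_weilCertOddC
  · exact checkNuAt80_weilCertOddC
  · exact checkNuAt82_weilCertOddC
  · exact checkNuAt84_weilCertOddC
  · exact checkNuAt86_weilCertOddC
  · exact checkNuAt88_weilCertOddC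
  · exact checkNuAt90_weilCertOddC
  · exact checkNuAt92_weilCertOddC
  · exact checkNuAt94_weilCertOddC
  · exact checkNuAt96_weilCertOddC
  · exact checkNuAt98_weilCertOddC
  · exact checkNuAt100_weilCertOddC
  · exact checkNuAt102_weilCertOddC
  · exact checkNuAt104_weilCertOddC
  · exact checkNuAt106_weilCertOddC
  · exact checkNuAt108_weilCertOddC
  · exact checkNuAt110_weilCertOddC
  · exact checkNuAt112_weilCertOddC
  · exact checkNuAt114_weilCertOddC
  · exact checkNuAt116_weilCertOddC
  · exact checkNuAt118_weilCertOddC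
  · exact checkNuAt120_weilCertOddC
  · exact checkNuAt122_weilCertOddC
  · exact checkNuAt124_weilCertOddC
  · exact checkNuAt126_weilCertOddC
  · exact checkNuAt128_weilCertOddC
  · exact checkNuAt130_weilCertOddC
  · exact checkNuAt132_weilCertOddC
  · exact checkNuAt134_weilCertOddC
  · exact checkNuAt136_weilCertOddC
  · exact checkNuAt138_weilCertOddC
  · exact checkNuAt140_weilCertOddC
  · exact checkNuAt142_weilCertOddC
  · exact checkNuAt144_weilCertOddC
  · exact checkNuAt146_weilCertOddC
  · exact checkNuAt148_weilCertOddC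
  · exact checkNuAt150_weilCertOddC
  · exact checkNuAt152_weilCertOddC
  · exact checkNuAt154_weilCertOddC
  · exact checkNuAt156_weilCertOddC
  · exact checkNuAt158_weilCertOddC
  · exact checkNuAt160_weilCertOddC
  · exact checkNuAt162_weilCertOddC
  · exact checkNuAt164_weilCertOddC
  · exact checkNuAt166_weilCertOddC
  · exact checkNuAt168_weilCertOddC
  · exact checkNuAt170_weilCertOddC
  · exact checkNuAt172_weilCertOddC
  · exact checkNuAt174_weilCertOddC
  · exact checkNuAt176_weilCertOddC
  · exact checkNuAt178_weilCertOddC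
  · exact checkNuAt180_weilCertOddC
  · exact checkNuAt182_weilCertOddC
  · exact checkNuAt184_weilCertOddC
  · exact checkNuAt186_weilCertOddC
  · exact checkNuAt188_weilCertOddC
  · exact checkNuAt190_weilCertOddC
  · exact checkNuAt192_weilCertOddC
  · exact checkNuAt194_weilCertOddC
  · exact checkNuAt196_weilCertOddC
  · exact checkNuAt198_weilCertOddC

/-- **The odd block of certificate C passes `checkBlockK` at `κ'`.** [folklore] -/
theorem checkBlock1_weilCertOddC : weilCertOddC.base.checkBlockK weilCertOddC.nuTab weilCertOddCKappa' 1 = true := by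
  refine WeilCert.checkBlockK_of_rows (fun i hi ↦ ?_) (fun i hi ↦ ?_)
  · have hi' : i < 50 := hi
    interval_cases i
    · exact checkDCRow1_0_weilCert3C
    · exact checkDCRow1_1_weilCert3C
    · exact checkDCRow1_2_weilCert3C
    · exact checkDCRow1_3_weilCert3C
    · exact checkDCRow1_4_weilCert3C
    · exact checkDCRow1_5_weilCert3C
    · exact checkDCRow1_6_weilCert3C
    · exact checkDCRow1_7_weilCert3C
    · exact checkDCRow1_8_weilCert3C
    · exact checkDCRow1_9_weilCert3C
    · exact checkDCRow1_10_weilCert3C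
    · exact checkDCRow1_11_weilCert3C
    · exact checkDCRow1_12_weilCert3C
    · exact checkDCRow1_13_weilCert3C
    · exact checkDCRow1_14_weilCert3C
    · exact checkDCRow1_15_weilCert3C
    · exact checkDCRow1_16_weilCert3C
    · exact checkDCRow1_17_weilCert3C
    · exact checkDCRow1_18_weilCert3C
    · exact checkDCRow1_19_weilCert3C
    · exact checkDCRow1_20_weilCert3C
    · exact checkDCRow1_21_weilCert3C
    · exact checkDCRow1_22_weilCert3C
    · exact checkDCRow1_23_weilCert3C
    · exact checkDCRow1_24_weilCert3C
    · exact checkDCRow1_25_weilCert3C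
    · exact checkDCRow1_26_weilCert3C
    · exact checkDCRow1_27_weilCert3C
    · exact checkDCRow1_28_weilCert3C
    · exact checkDCRow1_29_weilCert3C
    · exact checkDCRow1_30_weilCert3C
    · exact checkDCRow1_31_weilCert3C
    · exact checkDCRow1_32_weilCert3C
    · exact checkDCRow1_33_weilCert3C
    · exact checkDCRow1_34_weilCert3C
    · exact checkDCRow1_35_weilCert3C
    · exact checkDCRow1_36_weilCert3C
    · exact checkDCRow1_37_weilCert3C
    · exact checkDCRow1_38_weilCert3C
    · exact checkDCRow1_39_weilCert3C
    · exact checkDCRow1_40_weilCert3C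
    · exact checkDCRow1_41_weilCert3C
    · exact checkDCRow1_42_weilCert3C
    · exact checkDCRow1_43_weilCert3C
    · exact checkDCRow1_44_weilCert3C
    · exact checkDCRow1_45_weilCert3C
    · exact checkDCRow1_46_weilCert3C
    · exact checkDCRow1_47_weilCert3C
    · exact checkDCRow1_48_weilCert3C
    · exact checkDCRow1_49_weilCert3C
  · have hi' : i < 50 := hi
    interval_cases i
    · exact checkDomRow1_0_weilCertOddC
    · exact checkDomRow1_1_weilCertOddC
    · exact checkDomRow1_2_weilCertOddC
    · exact checkDomRow1_3_weilCertOddC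
    · exact checkDomRow1_4_weilCertOddC
    · exact checkDomRow1_5_weilCertOddC
    · exact checkDomRow1_6_weilCertOddC
    · exact checkDomRow1_7_weilCertOddC
    · exact checkDomRow1_8_weilCertOddC
    · exact checkDomRow1_9_weilCertOddC
    · exact checkDomRow1_10_weilCertOddC
    · exact checkDomRow1_11_weilCertOddC
    · exact checkDomRow1_12_weilCertOddC
    · exact checkDomRow1_13_weilCertOddC
    · exact checkDomRow1_14_weilCertOddC
    · exact checkDomRow1_15_weilCertOddC
    · exact checkDomRow1_16_weilCertOddC
    · exact checkDomRow1_17_weilCertOddC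
    · exact checkDomRow1_18_weilCertOddC
    · exact checkDomRow1_19_weilCertOddC
    · exact checkDomRow1_20_weilCertOddC
    · exact checkDomRow1_21_weilCertOddC
    · exact checkDomRow1_22_weilCertOddC
    · exact checkDomRow1_23_weilCertOddC
    · exact checkDomRow1_24_weilCertOddC
    · exact checkDomRow1_25_weilCertOddC
    · exact checkDomRow1_26_weilCertOddC
    · exact checkDomRow1_27_weilCertOddC
    · exact checkDomRow1_28_weilCertOddC
    · exact checkDomRow1_29_weilCertOddC
    · exact checkDomRow1_30_weilCertOddC
    · exact checkDomRow1_31_weilCertOddC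
    · exact checkDomRow1_32_weilCertOddC
    · exact checkDomRow1_33_weilCertOddC
    · exact checkDomRow1_34_weilCertOddC
    · exact checkDomRow1_35_weilCertOddC
    · exact checkDomRow1_36_weilCertOddC
    · exact checkDomRow1_37_weilCertOddC
    · exact checkDomRow1_38_weilCertOddC
    · exact checkDomRow1_39_weilCertOddC
    · exact checkDomRow1_40_weilCertOddC
    · exact checkDomRow1_41_weilCertOddC
    · exact checkDomRow1_42_weilCertOddC
    · exact checkDomRow1_43_weilCertOddC
    · exact checkDomRow1_44_weilCertOddC
    · exact checkDomRow1_45_weilCertOddC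
    · exact checkDomRow1_46_weilCertOddC
    · exact checkDomRow1_47_weilCertOddC
    · exact checkDomRow1_48_weilCertOddC
    · exact checkDomRow1_49_weilCertOddC

end Literature.NumberTheory.LFunctions
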